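import Summits.QuantumAdvantage.QuantumAdvantage.Theorems.NearExactIsExact.Negative.RankOneToolkit
import Summits.QuantumAdvantage.QuantumAdvantage.Theorems.NearExactIsExact.Negative.ColumnPencilPullback

/-!
# `NearExactIsExact` (stmt-QuantumAdvantage-14043) — THEOREM C2 (gen 38), part 2/2: column pencils
  with at least three fibre matrices never realise the flat residual

**Setting** (BQ-11, stratum `naff = 5`, `A = 0`, DISPROOF.md §46 of the b2b cell): over the twisted
`6`-bit frame `γ` (affine coordinates, one quadratic coordinate `i₀`), the biquadratic candidates are
`π(u,t) = (γ u, B(u) ⊕ M(u)t)`.  THEOREM TT kills `M` constant, THEOREM R1 the two-valued rank-one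
pencils.  THEOREM C2 (this file): COLUMN PENCILS `M(u) = I + v(u)·e₁ᵀ` — the matrix differs from `I`
in ONE column, `v(u) ⊥ e₁` an ARBITRARY function of `u` — taking AT LEAST THREE values:
for every quadratic `B`, all cubic `c₁, c₂`:  `c₁(u,w) ⊕ c₂(γu, w ⊕ w₁·v(u) ⊕ B(u)) ≠ 1_{u=0}`.
(Two values = THEOREM R1 after a constant change of block coordinates; one value = THEOREM TT.)

**Proof.** By `colPencil_pullback` (P1) the `s`-Möbius coefficients `G_T` of `s ↦ c₂(γu, B ⊕ s)`
agree with `(c₁)_T` for `1 ∉ T`; by (P3) and the constancy of cubic coefficients, for every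
`T = {x,y,z} ∌ 1` with `(c₁)_T = 1` the three relations at the pairs of `T` force
`v(u) = v⁰ ⊕ v_w(u)·ε` (`w` the fifth index), i.e. at most two values — so `(c₁)_T = 0`, hence
`C'_T := (coefC c₂ T) ∘ γ = 0` for all `|T| = 3`, `1 ∉ T` (`colPencil_cubic_vanish`).  The parity core
`colPencil_core` (pair identity + singleton expansions, bad pairs = the star at `1`, every cubic term
counted twice) then gives `Σ_u c₂(γu, B u) = 0`, while the zero section of the residual gives `1`.

HONEST FRAMING: the value here is a THEOREM (a kernel-checked negative lemma closing one infinite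
sub-family of the last Maiorana–McFarland habitat of `NearExactIsExact`), NOT summit progress; the crux
and the summit are untouched.
-/

set_option linter.dupNamespace false -- D-0017: single-problem summit ⇒ `QuantumAdvantage.QuantumAdvantage` by design

namespace Summit.QuantumAdvantage.QuantumAdvantage.Theorems.NearExactIsExact.Negative.ColumnPencil

open Finset
open Literature.Computability.QuantumComplexity
open Literature.Computability.QuantumComplexity.BuzetChailloux (bxor)
open Summit.QuantumAdvantage.QuantumAdvantage.Theorems.CubicForrelation.NearExactIsExact
  (fc_isDegLeFun_comp te_isDegLeFun_band tc_const_of_deg_zero)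
open Summit.QuantumAdvantage.QuantumAdvantage.Theorems.NearExactIsExact.Negative.SkewProductCore
open Summit.QuantumAdvantage.QuantumAdvantage.Theorems.NearExactIsExact.Negative.SkewProductResidual
open Summit.QuantumAdvantage.QuantumAdvantage.Theorems.NearExactIsExact.Negative.TwistedTranslation
open Summit.QuantumAdvantage.QuantumAdvantage.Theorems.NearExactIsExact.Negative.RankOneToolkit
open Summit.QuantumAdvantage.QuantumAdvantage.Theorems.NearExactIsExact.Negative.ColumnPencilPullback

/-- **THEOREM C2, parity core.** `ρ` quadratic, `deg C_∅ ≤ 5`, `deg C_k ≤ 3`, `deg G_m ≤ 3` (`m ≠ 1`),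
the pair coefficients `G_T`, `1 ∉ T`, affine, and `C_S = 0` for `|S| = 3`, `1 ∉ S`:
then `Σ_u Σ_{|S| ≤ 3} ρ^S C_S = 0`. [folklore] -/
theorem colPencil_core {ρ : Fin 5 → (Fin 6 → Bool) → Bool} (hρ : ∀ k, IsDegLeFun 2 (ρ k))
    {C : Finset (Fin 5) → (Fin 6 → Bool) → Bool} (hC0 : IsDegLeFun 5 (C ∅))
    (hC1 : ∀ k, IsDegLeFun 3 (C {k}))
    (hG1 : ∀ m : Fin 5, m ≠ 1 → IsDegLeFun 3 (fun u => decide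
      ((∑ S ∈ (P3 5).filter (fun S => ({m} : Finset (Fin 5)) ⊆ S),
        (∏ j ∈ S \ {m}, ind (ρ j u)) * ind (C S u)) = 1)))
    (hgood : ∀ T : Finset (Fin 5), T.card = 2 → (1 : Fin 5) ∉ T →
      IsDegLeFun 1 (fun u => decide ((∑ S ∈ (P3 5).filter (fun S => T ⊆ S),
        (∏ j ∈ S \ T, ind (ρ j u)) * ind (C S u)) = 1)))
    (hE : ∀ S ∈ P3 5, S.card = 3 → (1 : Fin 5) ∉ S → ∀ u, C S u = false) :
    ∑ u, texp C (fun m => ρ m u) u = 0 := by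
  have z2 : (2 : ZMod 2) = 0 := rfl
  obtain ⟨G, hGdef⟩ : ∃ G : Finset (Fin 5) → (Fin 6 → Bool) → ZMod 2, ∀ T u, G T u =
      ∑ S ∈ (P3 5).filter (fun S => T ⊆ S),
        (∏ m ∈ S \ T, ind (ρ m u)) * ind (C S u) := ⟨fun T u => _, fun _ _ => rfl⟩
  simp only [← hGdef] at hG1 hgood
  have hgoodsum : ∀ T : Finset (Fin 5), T.card = 2 → (1 : Fin 5) ∉ T →
      ∑ u, (∏ m ∈ T, ind (ρ m u)) * G T u = 0 := by
    intro T hT2 h1T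
    have hdeg : IsDegLeFun 5 (fun u => decide ((∏ m ∈ T, ind (ρ m u)) = 1) && decide (G T u = 1)) :=
      (te_isDegLeFun_band (isDegLeFun_prod (fun m => ρ m) T (fun m _ => hρ m)) (hgood T hT2 h1T)).mono
        (by rw [hT2])
    have h0 := sum_ind_eq_zero_of_deg_five hdeg
    refine (sum_congr rfl fun u _ => ?_).trans h0
    rw [ind_and, ind_decide_eq_one, ind_decide_eq_one]
  -- (E1) `ĉ_m = G_{m}`; (F2) `Σ_u ρ_m ĉ_m = 0` for `m ≠ 1`
  have hE1 : ∀ m u, tcoef ρ C m u = G {m} u := by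
    intro m u
    rw [hGdef]
    simp only [tcoef]
    refine sum_congr (filter_congr fun S _ => singleton_subset_iff.symm) fun S _ => ?_
    rw [sdiff_singleton_eq_erase]
  have hF2 : ∀ m : Fin 5, m ≠ 1 → ∑ u, ind (ρ m u) * tcoef ρ C m u = 0 := by
    intro m hm
    have hdeg : IsDegLeFun 5 (fun u => ρ m u && decide (G {m} u = 1)) :=
      te_isDegLeFun_band (hρ m) (hG1 m hm)
    have h0 := sum_ind_eq_zero_of_deg_five hdeg
    refine (sum_congr rfl fun u _ => ?_).trans h0
    rw [hE1, ind_and, ind_decide_eq_one]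
  -- expansion of `ρ_a ĉ_a`: the bad pair `{1,a}` equals the cubic terms through `a`
  have hexp : ∀ a u, ind (ρ a u) * tcoef ρ C a u =
      ind (ρ a u) * ind (C {a} u) +
      ∑ j ∈ univ.erase a, ind (ρ a u) * ind (ρ j u) * G {j, a} u +
      ∑ S ∈ (P3 5).filter (fun S => a ∈ S ∧ S.card = 3),
        (∏ i ∈ S, ind (ρ i u)) * ind (C S u) := by
    intro a u
    rw [ind_mul_tcoef_expand]
    simp only [hGdef]
  have hT1 : ∀ a, ∑ u, ind (ρ a u) * ind (C {a} u) = 0 := by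
    intro a
    have hdeg : IsDegLeFun 5 (fun u => ρ a u && C {a} u) :=
      (te_isDegLeFun_band (hρ a) (hC1 a)).mono (by norm_num)
    have h0 := sum_ind_eq_zero_of_deg_five hdeg
    refine (sum_congr rfl fun u _ => ?_).trans h0
    rw [ind_and]
  have hstep2 : ∀ a : Fin 5, a ≠ 1 →
      ∑ u, ind (ρ 1 u) * ind (ρ a u) * G {1, a} u =
        ∑ u, ∑ S ∈ (P3 5).filter (fun S => a ∈ S ∧ S.card = 3),
          (∏ i ∈ S, ind (ρ i u)) * ind (C S u) := by
    intro a ha1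
    have h := hF2 a ha1
    rw [sum_congr rfl fun u _ => hexp a u, sum_add_distrib, sum_add_distrib, hT1 a, zero_add] at h
    have hT2 : ∑ u, ∑ j ∈ univ.erase a, ind (ρ a u) * ind (ρ j u) * G {j, a} u =
        ∑ u, ind (ρ 1 u) * ind (ρ a u) * G {1, a} u := by
      rw [sum_comm, sum_eq_single_of_mem (1 : Fin 5) (mem_erase.mpr ⟨fun h => ha1 h.symm, mem_univ _⟩)]
      · exact sum_congr rfl fun u _ => by rw [mul_comm (ind (ρ a u)) (ind (ρ 1 u))]
      · intro j hj hj1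
        have hja : j ≠ a := (mem_erase.mp hj).1
        have h1 : (1 : Fin 5) ∉ ({j, a} : Finset (Fin 5)) := by
          simp only [mem_insert, mem_singleton, not_or]
          exact ⟨fun h => hj1 h.symm, fun h => ha1 h.symm⟩
        rw [← hgoodsum {j, a} (card_pair hja) h1]
        refine sum_congr rfl fun u _ => ?_
        rw [prod_pair hja, mul_comm (ind (ρ j u)) (ind (ρ a u))]
    rw [hT2] at h
    linear_combination h - (∑ u, ∑ S ∈ (P3 5).filter (fun S => a ∈ S ∧ S.card = 3),
      (∏ i ∈ S, ind (ρ i u)) * ind (C S u)) * z2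
  -- (STEP 1) the pair identity: only the bad pairs `{1,a}`, `a ≠ 1`, survive
  have hAsum : ∑ u : Fin 6 → Bool, ∑ S ∈ (P3 5).filter (fun S => S.card ≤ 1),
      (∏ m ∈ S, ind (ρ m u)) * ind (C S u) = 0 := by
    rw [sum_comm]
    refine sum_eq_zero fun S hS => ?_
    rw [mem_filter] at hS
    have hdeg : IsDegLeFun 5 (fun u => decide ((∏ m ∈ S, ind (ρ m u)) = 1) && C S u) := by
      rcases Nat.le_one_iff_eq_zero_or_eq_one.mp hS.2 with h0 | h1
      · rw [card_eq_zero] at h0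
        subst h0
        exact (te_isDegLeFun_band (isDegLeFun_prod (fun m => ρ m) ∅ (fun m _ => hρ m)) hC0).mono (by simp)
      · obtain ⟨k, rfl⟩ := card_eq_one.mp h1
        exact (te_isDegLeFun_band (isDegLeFun_prod (fun m => ρ m) {k} (fun m _ => hρ m)) (hC1 k)).mono
          (by simp)
    have h0 := sum_ind_eq_zero_of_deg_five hdeg
    refine (sum_congr rfl fun u _ => ?_).trans h0
    rw [ind_and, ind_decide_eq_one]
  have hstep1 : ∑ u, texp C (fun m => ρ m u) u =
      ∑ u, (ind (ρ 1 u) * ind (ρ 0 u) * G {1, 0} u + (ind (ρ 1 u) * ind (ρ 2 u) * G {1, 2} u +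
        (ind (ρ 1 u) * ind (ρ 3 u) * G {1, 3} u + ind (ρ 1 u) * ind (ρ 4 u) * G {1, 4} u))) := by
    have e : ∀ u, texp C (fun m => ρ m u) u =
        (∑ S ∈ (P3 5).filter (fun S => S.card ≤ 1), (∏ m ∈ S, ind (ρ m u)) * ind (C S u)) +
        ∑ T ∈ (univ : Finset (Fin 5)).powersetCard 2, (∏ m ∈ T, ind (ρ m u)) * G T u := by
      intro u
      rw [texp_split]
      simp only [hGdef]
    rw [sum_congr rfl fun u _ => e u, sum_add_distrib, hAsum, zero_add, sum_comm]
    have hbad : ({{1, 0}, {1, 2}, {1, 3}, {1, 4}} : Finset (Finset (Fin 5))) ⊆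
        (univ : Finset (Fin 5)).powersetCard 2 := by decide
    have key : ∀ T ∈ (univ : Finset (Fin 5)).powersetCard 2,
        T ∉ ({{1, 0}, {1, 2}, {1, 3}, {1, 4}} : Finset (Finset (Fin 5))) → (1 : Fin 5) ∉ T := by
      decide
    rw [← sum_subset hbad (fun T hT hTb => hgoodsum T (mem_powersetCard.mp hT).2 (key T hT hTb)),
      sum_insert (by decide), sum_insert (by decide), sum_insert (by decide), sum_singleton,
      ← sum_add_distrib, ← sum_add_distrib, ← sum_add_distrib]
    refine sum_congr rfl fun u _ => ?_
    rw [prod_pair (by decide : (1 : Fin 5) ≠ 0), prod_pair (by decide : (1 : Fin 5) ≠ 2),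
      prod_pair (by decide : (1 : Fin 5) ≠ 3), prod_pair (by decide : (1 : Fin 5) ≠ 4)]
  rw [hstep1, sum_add_distrib, sum_add_distrib, sum_add_distrib, hstep2 0 (by decide),
    hstep2 2 (by decide), hstep2 3 (by decide), hstep2 4 (by decide), ← sum_add_distrib,
    ← sum_add_distrib, ← sum_add_distrib]
  exact sum_eq_zero fun u _ => colPencil_bookkeeping (fun S => (∏ i ∈ S, ind (ρ i u)) * ind (C S u))
    (fun S hS h3 h1 => by rw [hE S hS h3 h1 u, ind_false, mul_zero])

/-- **THEOREM C2 (gen 38).** See the module docstring: `v` is an arbitrary function with `v(u)₁ = 0`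
taking at least three values (`v u₀, v u₁, v u₂` pairwise distinct). [folklore] -/
theorem colPencil_residual_ne_flat (γ : (Fin 6 → Bool) → (Fin 6 → Bool)) (i₀ : Fin 6)
    (hγa : ∀ i, i ≠ i₀ → IsDegLeFun 1 (fun u => γ u i)) (hγq : IsDegLeFun 2 (fun u => γ u i₀))
    (B : Fin 5 → (Fin 6 → Bool) → Bool) (hB : ∀ k, IsDegLeFun 2 (B k))
    (v : (Fin 6 → Bool) → Fin 5 → Bool) (hv1 : ∀ u, v u 1 = false)
    (u₀ u₁ u₂ : Fin 6 → Bool) (h01 : v u₀ ≠ v u₁) (h02 : v u₀ ≠ v u₂) (h12 : v u₁ ≠ v u₂)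
    (c₁ c₂ : (Fin (6 + 5) → Bool) → Bool) (h₁ : IsDegLeFun 3 c₁) (h₂ : IsDegLeFun 3 c₂) :
    ¬ ∀ (u : Fin 6 → Bool) (w : Fin 5 → Bool),
      (c₁ (Fin.append u w) ^^
        c₂ (Fin.append (γ u) (fun k => (w k ^^ (w 1 && v u k)) ^^ B k u))) =
        decide (∀ i, u i = false) := by
  intro h
  have z2 : (2 : ZMod 2) = 0 := rfl
  obtain ⟨G, hGdef⟩ : ∃ G : Finset (Fin 5) → (Fin 6 → Bool) → ZMod 2, ∀ T u, G T u =
      ∑ S ∈ (P3 5).filter (fun S => T ⊆ S),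
        (∏ m ∈ S \ T, ind (B m u)) * ind (coefC c₂ S (γ u)) := ⟨fun T u => _, fun _ _ => rfl⟩
  obtain ⟨hP1, hP3⟩ := colPencil_pullback γ B v hv1 c₁ c₂ h₁ h₂ h
  simp only [← hGdef] at hP1 hP3
  -- `G_T = C'_T` for `|T| = 3`; cubic coefficients are constants
  have hG3 : ∀ T : Finset (Fin 5), T.card = 3 → ∀ u, G T u = ind (coefC c₂ T (γ u)) := by
    intro T hT u
    rw [hGdef]
    have hs : (P3 5).filter (fun S => T ⊆ S) = {T} := by
      ext S
      simp only [mem_filter, mem_P3, mem_singleton]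
      constructor
      · rintro ⟨hS3, hTS⟩
        exact (eq_of_subset_of_card_le hTS (by omega)).symm
      · rintro rfl
        exact ⟨by omega, Subset.rfl⟩
    rw [hs, sum_singleton, Finset.sdiff_self, prod_empty, one_mul]
  have hconst₂ : ∀ T : Finset (Fin 5), T.card = 3 → ∀ x y, coefC c₂ T x = coefC c₂ T y := by
    intro T hT x y
    have h := coefC_deg c₂ h₂ T
    rw [hT] at h
    exact tc_const_of_deg_zero h x y
  have hconst₁ : ∀ T : Finset (Fin 5), T.card = 3 → ∀ x y, coefC c₁ T x = coefC c₁ T y := by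
    intro T hT x y
    have h := coefC_deg c₁ h₁ T
    rw [hT] at h
    exact tc_const_of_deg_zero h x y
  have hcard3 : ∀ a b c : Fin 5, a ≠ b → a ≠ c → b ≠ c → ({a, b, c} : Finset (Fin 5)).card = 3 := by
    intro a b c hab hac hbc
    have ha : a ∉ ({b, c} : Finset (Fin 5)) := by
      simp only [mem_insert, mem_singleton, not_or]; exact ⟨hab, hac⟩
    rw [card_insert_of_notMem ha, card_pair hbc]
  -- the brackets of (P3): `(c₁)_{jbc}` off the pair, `0` on the pair
  have hbr : ∀ j b c : Fin 5, j ≠ b → j ≠ c → ∀ u,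
      ind (dsum c₁ {b, c} (bxor (emb 5 u) (dir j))) + ind (dsum c₁ {b, c} (emb 5 u)) =
        ind (coefC c₁ {j, b, c} u) := by
    intro j b c hjb hjc u
    have hj : j ∉ ({b, c} : Finset (Fin 5)) := by
      simp only [mem_insert, mem_singleton, not_or]; exact ⟨hjb, hjc⟩
    have e := congrFun (dsum_insert c₁ hj) (emb 5 u)
    show _ = ind (dsum c₁ (insert j {b, c}) (emb 5 u))
    rw [e, ind_xor, add_comm]
  have hbr0 : ∀ b c : Fin 5, b ≠ c → ∀ u,
      ind (dsum c₁ {b, c} (bxor (emb 5 u) (dir b))) + ind (dsum c₁ {b, c} (emb 5 u)) = 0 := by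
    intro b c hbc u
    have hb : b ∉ ({c} : Finset (Fin 5)) := by rw [mem_singleton]; exact hbc
    have e := dsum_insert c₁ hb
    have hxx : bxor (bxor (emb 5 u) (dir b)) (dir b) = emb 5 u := by
      funext i
      show ((emb 5 u i ^^ dir b i) ^^ dir b i) = emb 5 u i
      cases emb 5 u i <;> cases dir b i <;> rfl
    show ind (dsum c₁ (insert b {c}) (bxor (emb 5 u) (dir b))) + ind (dsum c₁ (insert b {c}) (emb 5 u)) = 0
    rw [e]
    dsimp only
    rw [hxx, ind_xor, ind_xor]
    linear_combination (ind (dsum c₁ {c} (bxor (emb 5 u) (dir b))) + ind (dsum c₁ {c} (emb 5 u))) * z2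
  have hbr0' : ∀ b c : Fin 5, b ≠ c → ∀ u,
      ind (dsum c₁ {b, c} (bxor (emb 5 u) (dir c))) + ind (dsum c₁ {b, c} (emb 5 u)) = 0 := by
    intro b c hbc u
    rw [pair_comm b c]
    exact hbr0 c b (Ne.symm hbc) u
  -- the relation at the pair `{b,c}`: `C'_{1bc} = (c₁)_{1bc} + v_j (c₁)_{jbc} + v_{j'} (c₁)_{j'bc}`
  have hREL : ∀ b c j j' : Fin 5, b ≠ 1 → c ≠ 1 → b ≠ c → j ≠ 1 → j' ≠ 1 → j ≠ b → j ≠ c →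
      j' ≠ b → j' ≠ c → j ≠ j' → (univ : Finset (Fin 5)) = {1, b, c, j, j'} → ∀ u,
      ind (coefC c₂ {1, b, c} (γ u₀)) = ind (coefC c₁ {1, b, c} u₀) +
        (ind (v u j) * ind (coefC c₁ {j, b, c} u₀) + ind (v u j') * ind (coefC c₁ {j', b, c} u₀)) := by
    intro b c j j' hb1 hc1 hbc hj1 hj'1 hjb hjc hj'b hj'c hjj' hU u
    have e := hP3 b c hb1 hc1 hbc u
    rw [hG3 _ (hcard3 1 b c (Ne.symm hb1) (Ne.symm hc1) hbc) u] at e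
    have n1 : (1 : Fin 5) ∉ ({b, c, j, j'} : Finset (Fin 5)) := by
      simp only [mem_insert, mem_singleton, not_or]
      exact ⟨Ne.symm hb1, Ne.symm hc1, Ne.symm hj1, Ne.symm hj'1⟩
    have nb : b ∉ ({c, j, j'} : Finset (Fin 5)) := by
      simp only [mem_insert, mem_singleton, not_or]; exact ⟨hbc, Ne.symm hjb, Ne.symm hj'b⟩
    have nc : c ∉ ({j, j'} : Finset (Fin 5)) := by
      simp only [mem_insert, mem_singleton, not_or]; exact ⟨Ne.symm hjc, Ne.symm hj'c⟩
    have hsum : ∀ f : Fin 5 → ZMod 2, ∑ k, f k = f 1 + (f b + (f c + (f j + f j'))) := by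
      intro f
      rw [show (univ : Finset (Fin 5)) = {1, b, c, j, j'} from hU, sum_insert n1, sum_insert nb,
        sum_insert nc, sum_pair hjj']
    rw [hsum, hv1 u, ind_false, zero_mul, zero_add, hbr0 b c hbc u, mul_zero, zero_add,
      hbr0' b c hbc u, mul_zero, zero_add, hbr j b c hjb hjc u, hbr j' b c hj'b hj'c u,
      hconst₂ _ (hcard3 1 b c (Ne.symm hb1) (Ne.symm hc1) hbc) (γ u) (γ u₀),
      hconst₁ _ (hcard3 1 b c (Ne.symm hb1) (Ne.symm hc1) hbc) u u₀,
      hconst₁ _ (hcard3 j b c hjb hjc hbc) u u₀, hconst₁ _ (hcard3 j' b c hj'b hj'c hbc) u u₀] at e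
    exact e
  -- three values ⇒ every `(c₁)_T`, `|T| = 3`, `1 ∉ T`, vanishes
  have hind : ∀ a b : Bool, ind a = ind b → a = b := by decide
  have hvan : ∀ x y z w : Fin 5, x ≠ 1 → y ≠ 1 → z ≠ 1 → w ≠ 1 → x ≠ y → x ≠ z → x ≠ w → y ≠ z →
      y ≠ w → z ≠ w → (∀ k : Fin 5, k = 1 ∨ k = x ∨ k = y ∨ k = z ∨ k = w) →
      (univ : Finset (Fin 5)) = {1, y, z, x, w} → (univ : Finset (Fin 5)) = {1, x, z, y, w} →
      (univ : Finset (Fin 5)) = {1, x, y, z, w} → coefC c₁ {x, y, z} u₀ = false := by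
    intro x y z w hx1 hy1 hz1 hw1 hxy hxz hxw hyz hyw hzw hcov hU1 hU2 hU3
    have r1 := hREL y z x w hy1 hz1 hyz hx1 hw1 hxy hxz (Ne.symm hyw) (Ne.symm hzw) hxw hU1
    have r2 := hREL x z y w hx1 hz1 hxz hy1 hw1 (Ne.symm hxy) hyz (Ne.symm hxw) (Ne.symm hzw) hyw hU2
    have r3 := hREL x y z w hx1 hy1 hxy hz1 hw1 (Ne.symm hxz) (Ne.symm hyz) (Ne.symm hxw) (Ne.symm hyw)
      hzw hU3
    rw [Finset.insert_comm y x {z}] at r2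
    rw [Finset.insert_comm z x {y}, pair_comm z y] at r3
    cases hT : coefC c₁ {x, y, z} u₀
    · rfl
    exfalso
    simp only [hT, ind_true, mul_one] at r1 r2 r3
    -- `v` is determined by its coordinate `w`
    have htwo : ∀ u u', v u w = v u' w → v u = v u' := by
      intro u u' hw
      have ex : v u x = v u' x := by
        apply hind; have a := r1 u; have a' := r1 u'; rw [hw] at a; linear_combination a' - a
      have ey : v u y = v u' y := by
        apply hind; have a := r2 u; have a' := r2 u'; rw [hw] at a; linear_combination a' - a
      have ez : v u z = v u' z := by
        apply hind; have a := r3 u; have a' := r3 u'; rw [hw] at a; linear_combination a' - a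
      funext k
      rcases hcov k with rfl | rfl | rfl | rfl | rfl
      · rw [hv1, hv1]
      · exact ex
      · exact ey
      · exact ez
      · exact hw
    have key : ∀ a b c : Bool, a = b ∨ a = c ∨ b = c := by decide
    rcases key (v u₀ w) (v u₁ w) (v u₂ w) with e | e | e
    · exact h01 (htwo u₀ u₁ e)
    · exact h02 (htwo u₀ u₂ e)
    · exact h12 (htwo u₁ u₂ e)
  have hE : ∀ S ∈ P3 5, S.card = 3 → (1 : Fin 5) ∉ S → ∀ u, coefC c₂ S (γ u) = false := by
    have hc₁0 : ∀ S : Finset (Fin 5), S.card = 3 → (1 : Fin 5) ∉ S → coefC c₁ S u₀ = false := by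
      intro S hS h1S
      have hS' : S ∈ (univ : Finset (Fin 5)).powersetCard 3 := mem_powersetCard.mpr ⟨subset_univ _, hS⟩
      have hcases : ∀ S ∈ (univ : Finset (Fin 5)).powersetCard 3, (1 : Fin 5) ∉ S →
          S = {0, 2, 3} ∨ S = {0, 2, 4} ∨ S = {0, 3, 4} ∨ S = {2, 3, 4} := by decide
      rcases hcases S hS' h1S with rfl | rfl | rfl | rfl
      · exact hvan 0 2 3 4 (by decide) (by decide) (by decide) (by decide) (by decide) (by decide)
          (by decide) (by decide) (by decide) (by decide) (by decide) (by decide) (by decide) (by decide)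
      · exact hvan 0 2 4 3 (by decide) (by decide) (by decide) (by decide) (by decide) (by decide)
          (by decide) (by decide) (by decide) (by decide) (by decide) (by decide) (by decide) (by decide)
      · exact hvan 0 3 4 2 (by decide) (by decide) (by decide) (by decide) (by decide) (by decide)
          (by decide) (by decide) (by decide) (by decide) (by decide) (by decide) (by decide) (by decide)
      · exact hvan 2 3 4 0 (by decide) (by decide) (by decide) (by decide) (by decide) (by decide)
          (by decide) (by decide) (by decide) (by decide) (by decide) (by decide) (by decide) (by decide)
    intro S hS h3 h1S u
    have hne : S.Nonempty := by rw [← card_pos, h3]; norm_num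
    have e := hP1 S h1S hne u
    rw [hG3 S h3 u, decide_ind_eq_one, hconst₁ S h3 u u₀, hc₁0 S h3 h1S] at e
    exact e
  -- degrees of the pulled-back coefficients and of the good coefficients
  have hC0 : IsDegLeFun 5 (fun u => coefC c₂ (∅ : Finset (Fin 5)) (γ u)) := by
    have h := coefC_deg c₂ h₂ (∅ : Finset (Fin 5))
    rw [card_empty] at h
    exact (isDegLeFun_comp_twist (d := 2) h γ i₀ hγa hγq).mono (by norm_num)
  have hC1 : ∀ k : Fin 5, IsDegLeFun 3 (fun u => coefC c₂ {k} (γ u)) := fun k => by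
    have h := coefC_deg c₂ h₂ ({k} : Finset (Fin 5))
    rw [card_singleton] at h
    exact isDegLeFun_comp_twist (d := 1) h γ i₀ hγa hγq
  have hgood : ∀ T : Finset (Fin 5), T.card = 2 → (1 : Fin 5) ∉ T →
      IsDegLeFun 1 (fun u => decide (G T u = 1)) := by
    intro T hT2 h1T
    have hne : T.Nonempty := by rw [← card_pos, hT2]; norm_num
    have e : (fun u => decide (G T u = 1)) = coefC c₁ T := funext fun u => hP1 T h1T hne u
    rw [e]
    simpa [hT2] using coefC_deg c₁ h₁ T
  have hG1 : ∀ m : Fin 5, m ≠ 1 → IsDegLeFun 3 (fun u => decide (G {m} u = 1)) := by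
    intro m hm
    have e : (fun u => decide (G {m} u = 1)) = coefC c₁ {m} :=
      funext fun u => hP1 {m} (notMem_singleton.mpr hm.symm) (singleton_nonempty m) u
    rw [e]
    have hd := coefC_deg c₁ h₁ ({m} : Finset (Fin 5))
    rw [card_singleton] at hd
    exact hd.mono (by norm_num)
  -- the parity core gives `Σ_u c₂(γu, Bu) = 0` ...
  have hcore := colPencil_core (C := fun S u => coefC c₂ S (γ u)) hB hC0 hC1
    (fun m hm => by simpa only [hGdef] using hG1 m hm)
    (fun T hT2 h1T => by simpa only [hGdef] using hgood T hT2 h1T)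
    (fun S hS h3 h1S u => hE S hS h3 h1S u)
  -- ... while the zero section of the residual gives `1`
  have htexp1 : ∑ u, texp (fun S u => coefC c₂ S (γ u)) (fun m => B m u) u = 1 := by
    have h0 : ∀ u : Fin 6 → Bool,
        c₂ (Fin.append (γ u) (fun k => B k u)) = (c₁ (emb 5 u) ^^ decide (∀ i, u i = false)) := by
      intro u
      have h' := h u (fun _ => false)
      simp only [Bool.false_xor, Bool.false_and] at h'
      exact bool_solve _ _ _ h'
    have hc₁ : ∑ u, ind (c₁ (emb 5 u)) = 0 :=
      sum_ind_eq_zero_of_deg_five (fc_isDegLeFun_comp h₁ (emb 5) (emb_coord_deg 5) (by norm_num))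
    have hδ : ∑ u : Fin 6 → Bool, ind (decide (∀ i, u i = false)) = 1 := by
      rw [Finset.sum_eq_single (fun _ => false)]
      · simp
      · intro u _ hu
        have hu' : ¬ ∀ i, u i = false := fun h' => hu (funext h')
        simp [hu']
      · intro h'
        exact absurd (mem_univ _) h'
    have hsum2 : ∑ u, ind (c₂ (Fin.append (γ u) (fun k => B k u))) = 1 := by
      simp_rw [h0, ind_xor]
      rw [sum_add_distrib, hc₁, hδ, zero_add]
    rw [← hsum2]
    exact sum_congr rfl fun u _ => (expand_comp c₂ h₂ γ u _).symm
  rw [hcore] at htexp1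
  exact zero_ne_one htexp1

end Summit.QuantumAdvantage.QuantumAdvantage.Theorems.NearExactIsExact.Negative.ColumnPencil
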